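import Mathlib
import HarnessLib

/-!
# Stub `stub_dyadicAbel` of line `Sketch` (crux `HoelderEscapeProfile.LocalEnergyHalfHoelder`, item
stmt-AtomisticToContinuum-16008) — the DYADIC ABELIAN RECURSION

Pure real analysis.  If `f : ℝ → ℝ` is bounded on `[0, ∞)` (`|f| ≤ V`), Abel-integrable
(`t ↦ e^{-νt} f t` integrable on `(0, ∞)` for every `ν > 0`), and obeys the doubling recursion
`f (2s) ≤ a/√s + c·f s` for `s ≥ s₁ > 0` with `0 ≤ c < 2^{-1/2}`, then the Abel mean
`Ψ(ν) := ν ∫₀^∞ e^{-νt} f t dt` satisfies `Ψ(ν) ≤ C√ν` for `0 < ν ≤ 1`.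

Proof.
* `rec_extend`: the recursion extends to ALL `s > 0` with the constant
  `A = a⁺ + (1 + c)·V·√s₁` (for `s < s₁` one has `√(s₁/s) ≥ 1`, so the head is absorbed into the `1/√s` term).
* `abel_step`: substituting `t = 2s` (`MeasureTheory.integral_comp_mul_left_Ioi`) and integrating the pointwise
  recursion against `2ν e^{-2νs}` gives `Ψ(ν) ≤ K√ν + c·Ψ(2ν)` for every `ν > 0`, with
  `K = A·Γ(1/2)·√2` from `∫₀^∞ s^{-1/2} e^{-2νs} ds = Γ(1/2)(2ν)^{-1/2}` (`Real.integral_rpow_mul_exp_neg_mul_Ioi`).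
* `abel_le_bound`: the crude bound `Ψ(ν) ≤ V` (`∫₀^∞ e^{-νt} dt = 1/ν`).
* `dyadic_induction`: induction over the dyadic shells `ν > 2^{-(n+1)}`: `Ψ(ν) ≤ M√ν` with
  `M = K/(1 - c√2) + V√2`, using `c√2 < 1`.

`Stmt.stub_dyadicAbel` below is a VERBATIM copy of the statement abbreviation of the skeleton
`Cruxes/LocalEnergyHalfHoelder/Lines/Sketch.lean` (namespace `…Theorems.LocalEnergyHalfHoelder.NashDoubling` here, so
the skeleton can import this file without name clashes); `stub_dyadicAbel` proves it and
`stub_dyadicAbel_explicit` restates it unfolded.  Mathlib only; no named facts.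
-/

noncomputable section

open MeasureTheory Set

namespace Summit.AtomisticToContinuum.FouriersLaw.Theorems.LocalEnergyHalfHoelder.NashDoubling

/-- Extension of the doubling recursion from `s ≥ s₁` to all `s > 0`: with
`A = max a 0 + (1 + c)·V·√s₁` one has `f (2s) ≤ A/√s + c·f s` for every `s > 0`
(for `0 < s < s₁`: `f (2s) ≤ V`, `c·f s ≥ -cV` and `(1+c)V√s₁/√s ≥ (1+c)V`). -/
theorem rec_extend (f : ℝ → ℝ) (V a c s₁ : ℝ) (hbdd : ∀ t : ℝ, 0 ≤ t → |f t| ≤ V) (hc : 0 ≤ c)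
    (hrec : ∀ s : ℝ, s₁ ≤ s → f (2 * s) ≤ a / Real.sqrt s + c * f s) :
    ∀ s : ℝ, 0 < s →
      f (2 * s) ≤ (max a 0 + (1 + c) * V * Real.sqrt s₁) / Real.sqrt s + c * f s := by
  intro s hs
  have hV : 0 ≤ V := (abs_nonneg _).trans (hbdd 0 le_rfl)
  have hsq : 0 < Real.sqrt s := Real.sqrt_pos.mpr hs
  rw [add_div]
  have h0 : 0 ≤ max a 0 / Real.sqrt s := div_nonneg (le_max_right _ _) hsq.le
  rcases le_or_gt s₁ s with h | h
  · have h1 := hrec s h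
    have h2 : a / Real.sqrt s ≤ max a 0 / Real.sqrt s :=
      div_le_div_of_nonneg_right (le_max_left _ _) hsq.le
    have h3 : 0 ≤ (1 + c) * V * Real.sqrt s₁ / Real.sqrt s := by positivity
    linarith
  · have hf2 : f (2 * s) ≤ V := (le_abs_self _).trans (hbdd _ (by linarith))
    have hfs : -V ≤ f s := (abs_le.mp (hbdd s hs.le)).1
    have h3 : 1 ≤ Real.sqrt s₁ / Real.sqrt s := by
      rw [le_div_iff₀ hsq, one_mul]
      exact Real.sqrt_le_sqrt h.le
    have h4 : (1 + c) * V ≤ (1 + c) * V * Real.sqrt s₁ / Real.sqrt s := by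
      rw [mul_div_assoc]
      exact le_mul_of_one_le_right (by positivity) h3
    have h5 : c * (-V) ≤ c * f s := mul_le_mul_of_nonneg_left hfs hc
    linarith

/-- The crude bound on the Abel mean of a function bounded by `V` on `[0, ∞)`:
`ν ∫₀^∞ e^{-νt} f t dt ≤ ν ∫₀^∞ e^{-νt} V dt = V` (uses `∫_{(0,∞)} e^{-νt} dt = 1/ν`). -/
theorem abel_le_bound (f : ℝ → ℝ) (V ν : ℝ) (hν : 0 < ν)
    (hint : IntegrableOn (fun t : ℝ => Real.exp (-(ν * t)) * f t) (Ioi 0))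
    (hbdd : ∀ t : ℝ, 0 ≤ t → |f t| ≤ V) :
    ν * ∫ t in Ioi (0:ℝ), Real.exp (-(ν * t)) * f t ≤ V := by
  have hexpint : IntegrableOn (fun t : ℝ => Real.exp (-(ν * t))) (Ioi 0) := by
    simpa only [neg_mul] using exp_neg_integrableOn_Ioi 0 hν
  have hexp : ∫ t in Ioi (0:ℝ), Real.exp (-(ν * t)) = 1 / ν := by
    have h2 : ∫ t in Ioi (0:ℝ), Real.exp (-ν * t) = -Real.exp (-ν * 0) / -ν :=
      integral_exp_mul_Ioi (neg_lt_zero.mpr hν) 0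
    rw [mul_zero, Real.exp_zero, neg_div_neg_eq] at h2
    simpa only [neg_mul] using h2
  have hle : ∫ t in Ioi (0:ℝ), Real.exp (-(ν * t)) * f t ≤
      ∫ t in Ioi (0:ℝ), Real.exp (-(ν * t)) * V := by
    refine setIntegral_mono_on hint (hexpint.mul_const V) measurableSet_Ioi (fun t ht => ?_)
    exact mul_le_mul_of_nonneg_left ((le_abs_self _).trans (hbdd t (le_of_lt (mem_Ioi.mp ht))))
      (Real.exp_pos _).le
  calc ν * ∫ t in Ioi (0:ℝ), Real.exp (-(ν * t)) * f t
      ≤ ν * ∫ t in Ioi (0:ℝ), Real.exp (-(ν * t)) * V := mul_le_mul_of_nonneg_left hle hν.le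
    _ = V := by
        rw [integral_mul_const, hexp]
        field_simp

/-- One doubling step for the Abel mean.  If `f (2s) ≤ A/√s + c·f s` for all `s > 0` and
`t ↦ e^{-νt} f t` is integrable on `(0,∞)` for every `ν > 0`, then for every `ν > 0`
`ν∫₀^∞ e^{-νt} f t dt ≤ (A·Γ(1/2)·√2)·√ν + c·(2ν ∫₀^∞ e^{-2νt} f t dt)`:
substitute `t = 2s`, integrate the pointwise recursion against `e^{-2νs} > 0`, and use
`∫₀^∞ s^{-1/2} e^{-2νs} ds = (1/(2ν))^{1/2} Γ(1/2)`. -/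
theorem abel_step (f : ℝ → ℝ) (A c ν : ℝ) (hν : 0 < ν)
    (hint : ∀ ν : ℝ, 0 < ν → IntegrableOn (fun t : ℝ => Real.exp (-(ν * t)) * f t) (Ioi 0))
    (hrec : ∀ s : ℝ, 0 < s → f (2 * s) ≤ A / Real.sqrt s + c * f s) :
    ν * ∫ t in Ioi (0:ℝ), Real.exp (-(ν * t)) * f t ≤
      A * Real.Gamma (1 / 2) * Real.sqrt 2 * Real.sqrt ν +
        c * ((2 * ν) * ∫ t in Ioi (0:ℝ), Real.exp (-((2 * ν) * t)) * f t) := by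
  have h2ν : 0 < 2 * ν := by positivity
  -- the substitution `t = 2 s`
  have hsub : ∫ t in Ioi (0:ℝ), Real.exp (-(ν * t)) * f t =
      2 * ∫ s in Ioi (0:ℝ), Real.exp (-(ν * (2 * s))) * f (2 * s) := by
    have h := integral_comp_mul_left_Ioi (fun t => Real.exp (-(ν * t)) * f t) 0 (two_pos : (0:ℝ) < 2)
    simp only [mul_zero, smul_eq_mul] at h
    rw [h, ← mul_assoc, mul_inv_cancel₀ (two_ne_zero : (2:ℝ) ≠ 0), one_mul]
  -- integrability of the three integrands
  have hint1 : IntegrableOn (fun s : ℝ => Real.exp (-(ν * (2 * s))) * f (2 * s)) (Ioi 0) := by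
    have h := (integrableOn_Ioi_comp_mul_left_iff (fun t => Real.exp (-(ν * t)) * f t) 0
      (two_pos : (0:ℝ) < 2)).mpr
    simp only [mul_zero] at h
    exact h (hint ν hν)
  have hGamma : ∫ t in Ioi (0:ℝ), t ^ ((1 / 2 : ℝ) - 1) * Real.exp (-((2 * ν) * t)) =
      (1 / (2 * ν)) ^ (1 / 2 : ℝ) * Real.Gamma (1 / 2) :=
    Real.integral_rpow_mul_exp_neg_mul_Ioi (by norm_num) h2ν
  have hGpos : 0 < (1 / (2 * ν)) ^ (1 / 2 : ℝ) * Real.Gamma (1 / 2) :=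
    mul_pos (Real.rpow_pos_of_pos (by positivity) _) (Real.Gamma_pos_of_pos (by norm_num))
  have hint2 : IntegrableOn (fun t : ℝ => t ^ ((1 / 2 : ℝ) - 1) * Real.exp (-((2 * ν) * t))) (Ioi 0) := by
    by_contra h
    have h0 : (1 / (2 * ν)) ^ (1 / 2 : ℝ) * Real.Gamma (1 / 2) = 0 := by
      rw [← hGamma]
      exact integral_undef h
    exact hGpos.ne' h0
  have hint3 : IntegrableOn (fun t : ℝ => Real.exp (-((2 * ν) * t)) * f t) (Ioi 0) := hint (2 * ν) h2ν
  -- the pointwise recursion, weighted by `e^{-2νs}`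
  have hpt : ∀ s ∈ Ioi (0:ℝ), Real.exp (-(ν * (2 * s))) * f (2 * s) ≤
      A * (s ^ ((1 / 2 : ℝ) - 1) * Real.exp (-((2 * ν) * s))) +
        c * (Real.exp (-((2 * ν) * s)) * f s) := by
    intro s hs
    have hs' : 0 < s := hs
    have hE : Real.exp (-(ν * (2 * s))) = Real.exp (-((2 * ν) * s)) := by ring_nf
    have hpow : s ^ ((1 / 2 : ℝ) - 1) = 1 / Real.sqrt s := by
      rw [show (1 / 2 : ℝ) - 1 = -(1 / 2) by norm_num, Real.rpow_neg hs'.le, Real.sqrt_eq_rpow,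
        one_div (s ^ (1 / 2 : ℝ))]
    rw [hE, hpow]
    have hEpos : 0 < Real.exp (-((2 * ν) * s)) := Real.exp_pos _
    calc Real.exp (-((2 * ν) * s)) * f (2 * s)
        ≤ Real.exp (-((2 * ν) * s)) * (A / Real.sqrt s + c * f s) :=
          mul_le_mul_of_nonneg_left (hrec s hs') hEpos.le
      _ = A * (1 / Real.sqrt s * Real.exp (-((2 * ν) * s))) +
            c * (Real.exp (-((2 * ν) * s)) * f s) := by ring
  -- integrate
  have hmono : ∫ s in Ioi (0:ℝ), Real.exp (-(ν * (2 * s))) * f (2 * s) ≤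
      ∫ s in Ioi (0:ℝ), (A * (s ^ ((1 / 2 : ℝ) - 1) * Real.exp (-((2 * ν) * s))) +
        c * (Real.exp (-((2 * ν) * s)) * f s)) :=
    setIntegral_mono_on hint1 ((hint2.const_mul A).add (hint3.const_mul c)) measurableSet_Ioi hpt
  have hsplit : ∫ s in Ioi (0:ℝ), (A * (s ^ ((1 / 2 : ℝ) - 1) * Real.exp (-((2 * ν) * s))) +
        c * (Real.exp (-((2 * ν) * s)) * f s)) =
      A * ((1 / (2 * ν)) ^ (1 / 2 : ℝ) * Real.Gamma (1 / 2)) +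
        c * ∫ s in Ioi (0:ℝ), Real.exp (-((2 * ν) * s)) * f s := by
    rw [integral_add (hint2.const_mul A) (hint3.const_mul c), integral_const_mul, integral_const_mul,
      hGamma]
  -- `2ν · (1/(2ν))^{1/2} = √2 · √ν`
  have hroot : 2 * ν * (1 / (2 * ν)) ^ (1 / 2 : ℝ) = Real.sqrt 2 * Real.sqrt ν := by
    rw [← Real.sqrt_eq_rpow, one_div, Real.sqrt_inv, ← div_eq_mul_inv, Real.div_sqrt,
      Real.sqrt_mul' 2 hν.le]
  calc ν * ∫ t in Ioi (0:ℝ), Real.exp (-(ν * t)) * f t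
      = 2 * ν * ∫ s in Ioi (0:ℝ), Real.exp (-(ν * (2 * s))) * f (2 * s) := by rw [hsub]; ring
    _ ≤ 2 * ν * (A * ((1 / (2 * ν)) ^ (1 / 2 : ℝ) * Real.Gamma (1 / 2)) +
          c * ∫ s in Ioi (0:ℝ), Real.exp (-((2 * ν) * s)) * f s) := by
        rw [← hsplit]
        exact mul_le_mul_of_nonneg_left hmono h2ν.le
    _ = A * Real.Gamma (1 / 2) * (2 * ν * (1 / (2 * ν)) ^ (1 / 2 : ℝ)) +
          c * ((2 * ν) * ∫ t in Ioi (0:ℝ), Real.exp (-((2 * ν) * t)) * f t) := by ring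
    _ = A * Real.Gamma (1 / 2) * Real.sqrt 2 * Real.sqrt ν +
          c * ((2 * ν) * ∫ t in Ioi (0:ℝ), Real.exp (-((2 * ν) * t)) * f t) := by
        rw [hroot]; ring

/-- Dyadic bootstrap.  If `Ψ(ν) ≤ V` for all `ν > 0` (`V ≥ 0`) and `Ψ(ν) ≤ K√ν + c·Ψ(2ν)` for all `ν > 0`
(`K, c ≥ 0`, `c√2 < 1`), then `Ψ(ν) ≤ M√ν` on every dyadic shell `ν > 2^{-(n+1)}`, where
`M = K/(1 - c√2) + V√2`: base `ν > 1/2` from the crude bound (`√2·√ν ≥ 1`), step from the recursion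
(`K + c√2·M ≤ M`). -/
theorem dyadic_induction (Ψ : ℝ → ℝ) (K c V : ℝ) (hK : 0 ≤ K) (hc : 0 ≤ c) (hV : 0 ≤ V)
    (hq : c * Real.sqrt 2 < 1)
    (hbase : ∀ ν : ℝ, 0 < ν → Ψ ν ≤ V)
    (hstep : ∀ ν : ℝ, 0 < ν → Ψ ν ≤ K * Real.sqrt ν + c * Ψ (2 * ν)) :
    ∀ n : ℕ, ∀ ν : ℝ, (1 / 2 : ℝ) ^ (n + 1) < ν →
      Ψ ν ≤ (K / (1 - c * Real.sqrt 2) + V * Real.sqrt 2) * Real.sqrt ν := by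
  have hden : 0 < 1 - c * Real.sqrt 2 := by linarith
  have hKq : 0 ≤ K / (1 - c * Real.sqrt 2) := div_nonneg hK hden.le
  have hM : K + c * Real.sqrt 2 * (K / (1 - c * Real.sqrt 2) + V * Real.sqrt 2) ≤
      K / (1 - c * Real.sqrt 2) + V * Real.sqrt 2 := by
    have h1 : c * Real.sqrt 2 * (K / (1 - c * Real.sqrt 2)) = K / (1 - c * Real.sqrt 2) - K := by
      field_simp
      ring
    have h2 : 0 ≤ V * Real.sqrt 2 := by positivity
    nlinarith [mul_nonneg (mul_nonneg hc (Real.sqrt_nonneg 2)) h2]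
  intro n
  induction n with
  | zero =>
    intro ν hν
    norm_num at hν
    have hνpos : 0 < ν := by linarith
    have h1 : 1 ≤ Real.sqrt 2 * Real.sqrt ν := by
      rw [← Real.sqrt_mul' 2 hνpos.le]
      exact (Real.le_sqrt' one_pos).mpr (by nlinarith)
    calc Ψ ν ≤ V := hbase ν hνpos
      _ ≤ V * (Real.sqrt 2 * Real.sqrt ν) := le_mul_of_one_le_right hV h1
      _ = (V * Real.sqrt 2) * Real.sqrt ν := by ring
      _ ≤ (K / (1 - c * Real.sqrt 2) + V * Real.sqrt 2) * Real.sqrt ν := by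
          apply mul_le_mul_of_nonneg_right _ (Real.sqrt_nonneg ν)
          linarith
  | succ n ih =>
    intro ν hν
    have hνpos : 0 < ν := lt_trans (by positivity) hν
    have h2ν : (1 / 2 : ℝ) ^ (n + 1) < 2 * ν := by
      rw [pow_succ] at hν
      linarith
    have ih' := ih (2 * ν) h2ν
    rw [Real.sqrt_mul' 2 hνpos.le] at ih'
    have ih'' := mul_le_mul_of_nonneg_left ih' hc
    calc Ψ ν ≤ K * Real.sqrt ν + c * Ψ (2 * ν) := hstep ν hνpos
      _ ≤ K * Real.sqrt ν +
            c * ((K / (1 - c * Real.sqrt 2) + V * Real.sqrt 2) * (Real.sqrt 2 * Real.sqrt ν)) := by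
          linarith
      _ = (K + c * Real.sqrt 2 * (K / (1 - c * Real.sqrt 2) + V * Real.sqrt 2)) * Real.sqrt ν := by
          ring
      _ ≤ (K / (1 - c * Real.sqrt 2) + V * Real.sqrt 2) * Real.sqrt ν :=
          mul_le_mul_of_nonneg_right hM (Real.sqrt_nonneg ν)

/-- **Statement of stub `stub_dyadicAbel`** (verbatim copy of the skeleton's `Stmt.stub_dyadicAbel`,
`Cruxes/LocalEnergyHalfHoelder/Lines/Sketch.lean`; namespace `…Theorems.LocalEnergyHalfHoelder.NashDoubling` here, so
the skeleton can import this file without name clashes).  DYADIC ABELIAN RECURSION: if `f` is bounded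
(`|f| ≤ V` on `[0,∞)`), Abel-integrable, and obeys the doubling recursion `f(2s) ≤ a/√s + c·f(s)` for `s ≥ s₁`
with `0 ≤ c < 2^{-1/2}`, then `ν∫₀^∞e^{-νt}f ≤ C√ν` for small `ν`. -/
abbrev Stmt.stub_dyadicAbel : Prop :=
    ∀ (f : ℝ → ℝ) (V a c s₁ : ℝ), (∀ ν : ℝ, 0 < ν → MeasureTheory.IntegrableOn (fun t : ℝ => Real.exp (-(ν * t)) * f t) (Set.Ioi 0)) → (∀ t : ℝ, 0 ≤ t → |f t| ≤ V) → 0 ≤ c → c < 1 / Real.sqrt 2 → 0 < s₁ → (∀ s : ℝ, s₁ ≤ s → f (2 * s) ≤ a / Real.sqrt s + c * f s) → ∃ C ν₀ : ℝ, 0 < ν₀ ∧ ∀ ν : ℝ, 0 < ν → ν ≤ ν₀ → ν * ∫ t in Set.Ioi (0:ℝ), Real.exp (-(ν * t)) * f t ≤ C * Real.sqrt ν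

/-- **Stub `stub_dyadicAbel` (DYADIC ABELIAN RECURSION, registered stub of line `Sketch` of crux
`HoelderEscapeProfile.LocalEnergyHalfHoelder`).**  If `f : ℝ → ℝ` is bounded on `[0,∞)` (`|f t| ≤ V`),
Abel-integrable (`t ↦ e^{-νt} f t ∈ L¹(0,∞)` for every `ν > 0`) and obeys the doubling recursion
`f (2s) ≤ a/√s + c·f s` for `s ≥ s₁ > 0` with `0 ≤ c < 1/√2`, then there are `C` and `ν₀ > 0`
(here `ν₀ = 1`, `C = K/(1 - c√2) + V√2`, `K = (a⁺ + (1+c)V√s₁)·Γ(1/2)·√2`) with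
`ν ∫₀^∞ e^{-νt} f t dt ≤ C√ν` for all `0 < ν ≤ ν₀`.  Proof: `rec_extend` + `abel_step`
(substitution `t = 2s` and the Gamma integral give `Ψ(ν) ≤ K√ν + c·Ψ(2ν)`), `abel_le_bound`
(`Ψ ≤ V`) and `dyadic_induction` along `ν, 2ν, 4ν, …`. -/
theorem stub_dyadicAbel : Stmt.stub_dyadicAbel := by
  intro f V a c s₁ hint hbdd hc hc2 _hs₁ hrec
  have hV : 0 ≤ V := (abs_nonneg _).trans (hbdd 0 le_rfl)
  have hsqrt2 : 0 < Real.sqrt 2 := Real.sqrt_pos.mpr two_pos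
  have hq : c * Real.sqrt 2 < 1 := (lt_div_iff₀ hsqrt2).mp hc2
  -- the recursion for all `s > 0`
  obtain ⟨A, hA, hrecA⟩ : ∃ A : ℝ, 0 ≤ A ∧ ∀ s : ℝ, 0 < s → f (2 * s) ≤ A / Real.sqrt s + c * f s :=
    ⟨max a 0 + (1 + c) * V * Real.sqrt s₁, by positivity, rec_extend f V a c s₁ hbdd hc hrec⟩
  -- one doubling step, for every `ν > 0`
  obtain ⟨K, hK, hstep⟩ : ∃ K : ℝ, 0 ≤ K ∧ ∀ ν : ℝ, 0 < ν →
      ν * ∫ t in Ioi (0:ℝ), Real.exp (-(ν * t)) * f t ≤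
        K * Real.sqrt ν + c * ((2 * ν) * ∫ t in Ioi (0:ℝ), Real.exp (-((2 * ν) * t)) * f t) :=
    ⟨A * Real.Gamma (1 / 2) * Real.sqrt 2,
      mul_nonneg (mul_nonneg hA (Real.Gamma_pos_of_pos (by norm_num)).le) (Real.sqrt_nonneg 2),
      fun ν hν => abel_step f A c ν hν hint hrecA⟩
  have hclaim := dyadic_induction (fun ν => ν * ∫ t in Ioi (0:ℝ), Real.exp (-(ν * t)) * f t) K c V
    hK hc hV hq (fun ν hν => abel_le_bound f V ν hν (hint ν hν) hbdd) hstep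
  refine ⟨K / (1 - c * Real.sqrt 2) + V * Real.sqrt 2, 1, one_pos, fun ν hν _ => ?_⟩
  obtain ⟨n, hn⟩ := exists_pow_lt_of_lt_one hν (by norm_num : (1 / 2 : ℝ) < 1)
  have hn' : (1 / 2 : ℝ) ^ (n + 1) < ν :=
    lt_of_le_of_lt (pow_le_pow_of_le_one (by norm_num) (by norm_num) (Nat.le_succ n)) hn
  exact hclaim n ν hn'

/-- **Dyadic Abelian recursion, unfolded form** (the statement of `Stmt.stub_dyadicAbel` written out;
definitionally the same as `stub_dyadicAbel`). -/
theorem stub_dyadicAbel_explicit : ∀ (f : ℝ → ℝ) (V a c s₁ : ℝ), (∀ ν : ℝ, 0 < ν → MeasureTheory.IntegrableOn (fun t : ℝ => Real.exp (-(ν * t)) * f t) (Set.Ioi 0)) → (∀ t : ℝ, 0 ≤ t → |f t| ≤ V) → 0 ≤ c → c < 1 / Real.sqrt 2 → 0 < s₁ → (∀ s : ℝ, s₁ ≤ s → f (2 * s) ≤ a / Real.sqrt s + c * f s) → ∃ C ν₀ : ℝ, 0 < ν₀ ∧ ∀ ν : ℝ, 0 < ν → ν ≤ ν₀ → ν * ∫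 t in Set.Ioi (0:ℝ), Real.exp (-(ν * t)) * f t ≤ C * Real.sqrt ν :=
  stub_dyadicAbel

end Summit.AtomisticToContinuum.FouriersLaw.Theorems.LocalEnergyHalfHoelder.NashDoubling

end
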